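/-
Copyright: the b2b-balaban T⁴-continuum CRUX team, row NE7b OWNER lineage `t4-ne7b-p1` (gen 127). Project licence.
-/
import Mathlib.Probability.Distributions.Gaussian.HasGaussianLaw.Independence
import Mathlib.Probability.Distributions.Gaussian.Multivariate
import Literature.Probability.LatticeModels.LocalPerturbationPolymerGas
import Literature.Analysis.Matrix.FiniteRangeDecomposition

/-!
# A GAUSSIAN FIELD WITH A FINITE-RANGE COVARIANCE IS A FINITE-RANGE-DEPENDENT REFERENCE PROCESS: for a positive semidefinite `Γ` on a
# finite carrier `ι` of range `ρ` for a pseudo-distance `dι` (e.g. every piece `Γ_N` of (273)'s decomposition of the fluctuation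
# covariance), the coordinates of Mathlib's `multivariateGaussian μ₀ Γ` restricted to two families of cells whose sites are pairwise
# `> ρ` apart are INDEPENDENT (jointly Gaussian + zero cross-covariance, Mathlib's `HasGaussianLaw.indepFun_of_covariance_eval`), hence the
# cell σ-algebras satisfy the `indep` clause of the tree's `IsLocalPerturbation` for any cell adjacency `R` that covers `ρ`-closeness — so EVERY
# local perturbation `∏_p (1 + g_p)` of such a field (cell factors `𝓕_p`-measurable, `‖g_p‖ ≤ ε`) IS an `IsLocalPerturbation`, and the tree's
# polymer-gas ∕ Kotecký–Preiss theorems (`LocalPerturbationPolymerGas`, `LocalPerturbationClusterExpansion`: polymer representation,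
# zero-freeness, `‖log Z(C)‖ ≤ #C(Δ+1)2eε` uniformly in the volume) apply BY NAME (row NE7b, node U5c; [folklore] —
# [BauerschmidtBrydgesSlade2019] §3.3 «the finite-range property implies factorisation»)

Cell `pub-balaban`, sub-cell `t4`, spine estimate NE7b (`T4WeightBudget.RelWeightBound`; the cell's OWN estimate — NOT PRINTED in
[Bałaban 1983–89], NOT PROVED).  Crux-route work under `Spine/NE7b/` by the row OWNER (`t4-ne7b-p1` gen 127, file (276)) under FREEZE
(0)'s crux-prover clause, on § [NE7bP1-G126-HANDOFF] NEXT (3)(d) ((d2)'s reference-process hypothesis); generic (any finite `ι`, any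
cells `cell : V → Finset ι`); NOTHING of Bałaban's is named as a Lean object, valued or asserted; no `T4Continuum/Support` leaf typed; no
`def`, no notation (the cell σ-algebras are displayed `MeasurableSpace.comap`s of the restriction maps); zero `sorry`.  Imports (BY NAME):
Mathlib's `ProbabilityTheory.multivariateGaussian`, `covariance_eval_multivariateGaussian`, `HasGaussianLaw.indepFun_of_covariance_eval`,
`IsGaussian.hasGaussianLaw_id`, `HasGaussianLaw.map_of_measurable`, `IndepFun_iff_Indep`, `indep_of_indep_of_le_left∕right`,
`MeasurableSpace.comap_comp∕comap_mono`, `measurable_iff_comap_le`; the tree's `Literature/Probability/LatticeModels/LocalPerturbationPolymerGas`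
(`Touches`, `IsLocalPerturbation`) and `Literature/Analysis/Matrix/FiniteRangeDecomposition` (`HasFiniteRange`).

WHY (located).  (273) wrote the road's fluctuation covariance as `Σ_{N<J} Γ_N + Γ_J^{rem}` with `Γ_N ≥ 0` of finite range; the
finite-range route to the cluster-expansion step (d2) integrates the field piece by piece, and at each piece the tree's polymer-gas
machinery needs exactly one probabilistic input about the reference measure — cell sets that do not touch generate independent
σ-algebras.  For a Gaussian field this is «uncorrelated ⟹ independent», which Mathlib (2026) carries for jointly Gaussian finite families;
this file reads it for the coordinates of `multivariateGaussian μ₀ Γ` on `EuclideanSpace ℝ ι` restricted to unions of cells, and packages the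
result as the constructor of `IsLocalPerturbation`.  No size estimate is involved.

WHAT IS PROVED ([folklore]; `ι` finite with decidable equality, `Γ` positive semidefinite, any mean `μ₀`):
* §1 `hasGaussianLaw_restrict_pair` (the pair of restrictions to two site sets is jointly Gaussian), **`indepFun_restrict_of_covariance_zero`**
  (`Γ(x,y) = 0` for `x ∈ S`, `y ∈ T` ⟹ the restrictions to `S` and `T` are independent).
* §2 `comap_restrict_mono`, `iSup_comap_cell_le` (the cell σ-algebras of `K` lie below the σ-algebra of the restriction to `⋃_{p∈K} cell p`).
* §3 **`gaussian_indep_of_far`** (`Γ` of range `ρ`, all sites of `K₁`'s cells `> ρ` from all sites of `K₂`'s cells ⟹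
  `Indep (⨆_{p∈K₁} 𝓕_p) (⨆_{p∈K₂} 𝓕_p)`), **`gaussian_indep_of_not_touches`** (the same from `¬Touches R K₁ K₂` for any adjacency `R` covering
  `ρ`-closeness of cells).
* §4 THE END **`isLocalPerturbation_gaussian`**: such a field with ANY family of `𝓕_p`-measurable cell factors bounded by `ε ≥ 0` is an
  `IsLocalPerturbation (multivariateGaussian μ₀ Γ) R 𝓕 g ε` — the hypothesis of every theorem of `LocalPerturbationPolymerGas` ∕
  `LocalPerturbationClusterExpansion`; §5 toy (the two coordinates of the standard Gaussian on `ℝ²` are independent).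

HONEST (what this is NOT).  Mathlib's Gaussian independence read on coordinates + σ-algebra bookkeeping; no estimate; the smallness
`‖g_p‖ ≤ ε` of the road's cell factors (from the potential and the covariance's size) and the Dobrushin∕KP threshold are the successor's; the
identification of the road's fluctuation measure (pushforward of (271)'s `gaussProb M_z` by `P`) with `multivariateGaussian 0 C` and its
splitting along (273)'s pieces as a convolution (the tree's `multivariateGaussian_conv_multivariateGaussian`) are not typed here; scalar
skeleton ((A3), NC-NE7b-α UNRULED); nothing of Bałaban's asserted.  BY-NAME EFFECT ON THE WALL: NONE.  NE7b NOT PRINTED ∕ NOT PROVED; spine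
PROVED 0∕9; rung (B)+1 — the programme's measures remain FINITE-torus statements; NOT the mass gap, NOT Clay.  HONEST DEPENDENCY: continuum
YM on T⁴ ⇐ BetaPertH ∧ nine spine estimates (0∕9 proved); BetaPertH ⇐ (D1) ∧ (D4) ∧ CAP+tail; G-an2-4 gates asym, D1 and NE2∕3∕4.
-/

set_option autoImplicit false

noncomputable section

namespace Summit.QuantumFields.BalabanUV.T4Continuum.NE7b.SupGaussianFiniteRangeDependence

open MeasureTheory ProbabilityTheory
open Literature.Probability.LatticeModels (Touches IsLocalPerturbation)
open Literature.Analysis.Matrix (HasFiniteRange)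

variable {ι : Type} [Fintype ι] [DecidableEq ι] {V : Type*}

/-! ## §1. Restrictions of the Gaussian field: jointly Gaussian; independent when uncorrelated -/

/-- **THE PAIR OF RESTRICTIONS IS JOINTLY GAUSSIAN**: for every mean `μ₀`, matrix `Γ` and site sets `S, T`, the map
`ω ↦ (ω|_S, ω|_T)` has a Gaussian law under `multivariateGaussian μ₀ Γ` (a continuous linear image of a Gaussian measure). [folklore] -/
theorem hasGaussianLaw_restrict_pair (μ₀ : EuclideanSpace ℝ ι) (Γ : Matrix ι ι ℝ) (S T : Finset ι) :
    HasGaussianLaw (fun ω : EuclideanSpace ℝ ι => (fun x : S => ω x, fun y : T => ω y)) (multivariateGaussian μ₀ Γ) := by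
  let L : EuclideanSpace ℝ ι →L[ℝ] (S → ℝ) × (T → ℝ) :=
    (ContinuousLinearMap.pi fun x : S => EuclideanSpace.proj (x : ι)).prod
      (ContinuousLinearMap.pi fun y : T => EuclideanSpace.proj (y : ι))
  have hL : (fun ω : EuclideanSpace ℝ ι => (fun x : S => ω x, fun y : T => ω y)) = L ∘ id := by
    funext ω
    rfl
  rw [hL]
  exact IsGaussian.hasGaussianLaw_id.map_of_measurable L L.continuous.measurable

/-- **UNCORRELATED RESTRICTIONS OF A GAUSSIAN FIELD ARE INDEPENDENT**: `Γ` positive semidefinite, `Γ(x,y) = 0` for all `x ∈ S`, `y ∈ T` ⟹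
the restrictions to `S` and to `T` are independent under `multivariateGaussian μ₀ Γ`. [folklore] -/
theorem indepFun_restrict_of_covariance_zero {Γ : Matrix ι ι ℝ} (hΓ : Γ.PosSemidef) (μ₀ : EuclideanSpace ℝ ι) (S T : Finset ι)
    (h0 : ∀ x ∈ S, ∀ y ∈ T, Γ x y = 0) :
    IndepFun (fun (ω : EuclideanSpace ℝ ι) (x : S) => ω x) (fun (ω : EuclideanSpace ℝ ι) (y : T) => ω y)
      (multivariateGaussian μ₀ Γ) :=
  (hasGaussianLaw_restrict_pair μ₀ Γ S T).indepFun_of_covariance_eval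
    (X := fun (x : S) (ω : EuclideanSpace ℝ ι) => ω x) (Y := fun (y : T) (ω : EuclideanSpace ℝ ι) => ω y) fun x y => by
    rw [covariance_eval_multivariateGaussian hΓ]
    exact h0 x x.2 y y.2

/-! ## §2. The cell σ-algebras -/

omit [Fintype ι] [DecidableEq ι] in
/-- The σ-algebra of the restriction to `A` lies below that of the restriction to any `B ⊇ A`. [folklore] -/
theorem comap_restrict_mono {A B : Finset ι} (hAB : A ⊆ B) :
    MeasurableSpace.comap (fun (ω : EuclideanSpace ℝ ι) (x : A) => ω x) inferInstance
      ≤ MeasurableSpace.comap (fun (ω : EuclideanSpace ℝ ι) (x : B) => ω x) inferInstance := by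
  have e : (fun (ω : EuclideanSpace ℝ ι) (x : A) => ω x)
      = (fun (f : B → ℝ) (x : A) => f ⟨x, hAB x.2⟩) ∘ (fun (ω : EuclideanSpace ℝ ι) (x : B) => ω x) := rfl
  rw [e, ← MeasurableSpace.comap_comp]
  exact MeasurableSpace.comap_mono (measurable_iff_comap_le.1 (by fun_prop))

omit [Fintype ι] in
/-- **THE CELL σ-ALGEBRAS OF `K` LIE BELOW THE RESTRICTION TO `⋃_{p ∈ K} cell p`.** [folklore] -/
theorem iSup_comap_cell_le (cell : V → Finset ι) (K : Finset V) :
    (⨆ p ∈ K, MeasurableSpace.comap (fun (ω : EuclideanSpace ℝ ι) (x : cell p) => ω x) inferInstance)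
      ≤ MeasurableSpace.comap (fun (ω : EuclideanSpace ℝ ι) (x : K.biUnion cell) => ω x) inferInstance :=
  iSup₂_le fun _ hp => comap_restrict_mono (Finset.subset_biUnion_of_mem cell hp)

/-! ## §3. Finite range of the covariance ⟹ finite-range dependence -/

/-- **FINITE RANGE ⟹ FINITE-RANGE DEPENDENCE**: `Γ` positive semidefinite of range `ρ` for `dι`, and every site of a cell of `K₁` more than
`ρ` away from every site of a cell of `K₂` ⟹ the σ-algebras generated by the cells of `K₁` and of `K₂` are independent under
`multivariateGaussian μ₀ Γ`. [folklore] -/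
theorem gaussian_indep_of_far {Γ : Matrix ι ι ℝ} (hΓ : Γ.PosSemidef) (μ₀ : EuclideanSpace ℝ ι) (cell : V → Finset ι)
    {dι : ι → ι → ℕ} {ρ : ℕ} (hfr : HasFiniteRange dι ρ Γ) (K₁ K₂ : Finset V)
    (hfar : ∀ p ∈ K₁, ∀ p' ∈ K₂, ∀ x ∈ cell p, ∀ y ∈ cell p', ρ < dι x y) :
    Indep (⨆ p ∈ K₁, MeasurableSpace.comap (fun (ω : EuclideanSpace ℝ ι) (x : cell p) => ω x) inferInstance)
      (⨆ p ∈ K₂, MeasurableSpace.comap (fun (ω : EuclideanSpace ℝ ι) (x : cell p) => ω x) inferInstance)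
      (multivariateGaussian μ₀ Γ) := by
  classical
  have h := indepFun_restrict_of_covariance_zero hΓ μ₀ (K₁.biUnion cell) (K₂.biUnion cell) fun x hx y hy => by
    obtain ⟨p, hp, hxp⟩ := Finset.mem_biUnion.1 hx
    obtain ⟨p', hp', hyp⟩ := Finset.mem_biUnion.1 hy
    exact hfr x y (hfar p hp p' hp' x hxp y hyp)
  rw [IndepFun_iff_Indep] at h
  exact indep_of_indep_of_le_right (indep_of_indep_of_le_left h (iSup_comap_cell_le cell K₁)) (iSup_comap_cell_le cell K₂)

/-- **THE `indep` CLAUSE OF `IsLocalPerturbation`**: if the cell adjacency `R` covers `ρ`-closeness (two cells with sites `≤ ρ` apart are equal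
or adjacent), then cell sets that do not touch generate independent σ-algebras. [folklore] -/
theorem gaussian_indep_of_not_touches {Γ : Matrix ι ι ℝ} (hΓ : Γ.PosSemidef) (μ₀ : EuclideanSpace ℝ ι) (cell : V → Finset ι)
    {dι : ι → ι → ℕ} {ρ : ℕ} (hfr : HasFiniteRange dι ρ Γ) {R : V → V → Prop}
    (hR : ∀ (p p' : V) (x y : ι), x ∈ cell p → y ∈ cell p' → dι x y ≤ ρ → p = p' ∨ R p p') (K₁ K₂ : Finset V)
    (hKK : ¬ Touches R K₁ K₂) :
    Indep (⨆ p ∈ K₁, MeasurableSpace.comap (fun (ω : EuclideanSpace ℝ ι) (x : cell p) => ω x) inferInstance)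
      (⨆ p ∈ K₂, MeasurableSpace.comap (fun (ω : EuclideanSpace ℝ ι) (x : cell p) => ω x) inferInstance)
      (multivariateGaussian μ₀ Γ) :=
  gaussian_indep_of_far hΓ μ₀ cell hfr K₁ K₂ fun p hp p' hp' x hx y hy =>
    not_le.1 fun hle => hKK ⟨p, hp, p', hp', hR p p' x y hx hy hle⟩

/-! ## §4. THE END: local perturbations of a finite-range Gaussian field -/

/-- **HEADLINE — A LOCAL PERTURBATION OF A FINITE-RANGE GAUSSIAN FIELD IS AN `IsLocalPerturbation`.**  `Γ` positive semidefinite of range `ρ`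
for `dι`; cells `cell : V → Finset ι` with an adjacency `R` covering `ρ`-closeness; cell factors `g_p` measurable for the cell σ-algebras and
bounded by `ε ≥ 0` ⟹ `IsLocalPerturbation (multivariateGaussian μ₀ Γ) R 𝓕 g ε` with `𝓕_p = σ(ω|_{cell p})` — so the tree's polymer
representation, zero-freeness, exclusion costs and Kotecký–Preiss extensivity apply to `∫ ∏_p (1 + g_p) d(multivariateGaussian μ₀ Γ)` by
name. [folklore] -/
theorem isLocalPerturbation_gaussian {Γ : Matrix ι ι ℝ} (hΓ : Γ.PosSemidef) (μ₀ : EuclideanSpace ℝ ι) (cell : V → Finset ι)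
    {dι : ι → ι → ℕ} {ρ : ℕ} (hfr : HasFiniteRange dι ρ Γ) {R : V → V → Prop}
    (hR : ∀ (p p' : V) (x y : ι), x ∈ cell p → y ∈ cell p' → dι x y ≤ ρ → p = p' ∨ R p p')
    (g : V → EuclideanSpace ℝ ι → ℂ) {ε : ℝ} (hε : 0 ≤ ε)
    (hmeas : ∀ p, Measurable[MeasurableSpace.comap (fun (ω : EuclideanSpace ℝ ι) (x : cell p) => ω x) inferInstance] (g p))
    (hbound : ∀ p ω, ‖g p ω‖ ≤ ε) :
    IsLocalPerturbation (multivariateGaussian μ₀ Γ) R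
      (fun p => MeasurableSpace.comap (fun (ω : EuclideanSpace ℝ ι) (x : cell p) => ω x) inferInstance) g ε where
  le := fun _ => measurable_iff_comap_le.1 (by fun_prop)
  indep := fun K₁ K₂ hKK => gaussian_indep_of_not_touches hΓ μ₀ cell hfr hR K₁ K₂ hKK
  measurable := hmeas
  norm_le := hbound
  nonneg := hε

/-! ## §5. Toy -/

/-- Toy: under the standard Gaussian on `ℝ²` (`Γ = 1`) the first and the second coordinate are independent (`Γ(0,1) = 0`). -/
example : IndepFun (fun (ω : EuclideanSpace ℝ (Fin 2)) (x : ({0} : Finset (Fin 2))) => ω x)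
    (fun (ω : EuclideanSpace ℝ (Fin 2)) (y : ({1} : Finset (Fin 2))) => ω y) (multivariateGaussian 0 (1 : Matrix (Fin 2) (Fin 2) ℝ)) :=
  indepFun_restrict_of_covariance_zero Matrix.PosSemidef.one 0 {0} {1} fun x hx y hy => by
    rw [Finset.mem_singleton] at hx hy
    subst hx hy
    exact Matrix.one_apply_ne (by decide)

end Summit.QuantumFields.BalabanUV.T4Continuum.NE7b.SupGaussianFiniteRangeDependence
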